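import Summits.AtomisticToContinuum.FouriersLaw.Theorems.PhononMeanFreePathIncoherentChannelLightConeHelper3
import Literature.MathematicalPhysics.KineticTheory.LangevinChainScalingLimit

/-!
# Light-cone stub, helper 4: the pathwise light cone of the Langevin-driven pinned chain

Helper for the registered stub `stub_lightCone` of line `two-horizons-forecast-loss`
(crux `PhononMeanFreePath.IncoherentChannel`, stmt-AtomisticToContinuum-11811), registered sub-goal
`lightCone_pathwise`.

Two solutions `z, z'` of the SAME noise-driven chain `P = pinnedChain ω₂ lam β γ` (`ω₂ > 0`,
`lam, β, γ ≥ 0`, `n+1` sites; `OscillatorChain.chainFlow` / `solMap`, same noise path) started from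
microstates that differ ONLY in the momentum `p₀` stay super-polynomially close at the far site `n`
until the cone `A(t) ≈ n`:

  `(p_n(t) - p_n'(t))² ≤ (p₀ - p₀')² · e^{A(t)} · A(t)^n / n!`,
  `A(t) = 4∫₀ᵗ (1 + 5 L(s)) ds`,  `L(s) = (ω₂+1) + 8(lam+β)(‖q(s)‖² + ‖q'(s)‖²)`

(`lightCone_chainFlow_pathwise`, and `lightCone_pathwise` for the solution map `solMap` driving the
transition kernels). The noise CANCELS in the difference `δ = z - z'`, which is `C¹` with
`δ̇ = Y(z) - Y(z')` (`Y` the drift); the site energies `e_j = δq_j² + δp_j²` obey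
`e_j' ≤ (1 + 5L)(e_{j-1} + e_j + e_{j+1})` because the force is nearest-neighbour with the local
Lipschitz factor `L` (`lightCone_dPotential_sub_le`: `|U''| ≤ ω₂ + 3 lam q²`, `|V''| ≤ 1 + 3βr²`), and
helper 3 (`lightCone_lattice_gronwall`) closes the hierarchy. The rate is UNBOUNDED along the path
(anharmonicity): the light cone is as good as the Gibbs control of `∫₀ᵗ ‖q(s)‖²_∞ ds`.
-/

noncomputable section

namespace Summit.AtomisticToContinuum.FouriersLaw.Theorems.PhononMeanFreePath

open MeasureTheory Set Filter Topology
open scoped NNReal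
open Literature.MathematicalPhysics.KineticTheory.HeatConduction
open Literature.MathematicalPhysics.KineticTheory Literature.Probability.Process OscillatorChain

/-! ### Local Lipschitz bounds for the pinned-chain forces -/

section Force

variable {ω₂ lam β γ : ℝ} {n : ℕ}

/-- A coordinate is bounded by the sup norm: `q_i² ≤ ‖q‖²`. -/
theorem lightCone_sq_apply_le {m : ℕ} (q : Fin m → ℝ) (i : Fin m) : q i ^ 2 ≤ ‖q‖ ^ 2 := by
  have h : |q i| ≤ ‖q‖ := by rw [← Real.norm_eq_abs]; exact norm_le_pi_norm q i
  have h0 : 0 ≤ ‖q‖ := norm_nonneg _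
  nlinarith [abs_nonneg (q i), sq_abs (q i)]

/-- `|U'(a) - U'(b)| ≤ (ω₂ + 2 lam (a² + b²)) |a - b|` for `U'(q) = ω₂ q + lam q³` (`ω₂ > 0`, `lam ≥ 0`). -/
theorem lightCone_deriv_U_sub_le (hω : 0 < ω₂) (hl : 0 ≤ lam) (a b : ℝ) :
    |deriv (pinnedChain ω₂ lam β γ).U a - deriv (pinnedChain ω₂ lam β γ).U b| ≤
      (ω₂ + 2 * lam * (a ^ 2 + b ^ 2)) * |a - b| := by
  rw [pinnedChain_deriv_U, pinnedChain_deriv_U]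
  have e : ω₂ * a + lam * a ^ 3 - (ω₂ * b + lam * b ^ 3) = (ω₂ + lam * (a ^ 2 + a * b + b ^ 2)) * (a - b) := by ring
  rw [e, abs_mul]
  refine mul_le_mul_of_nonneg_right ?_ (abs_nonneg _)
  have h1 : 0 ≤ a ^ 2 + a * b + b ^ 2 := by nlinarith [sq_nonneg (a + b), sq_nonneg a, sq_nonneg b]
  have h2 : a ^ 2 + a * b + b ^ 2 ≤ 2 * (a ^ 2 + b ^ 2) := by nlinarith [sq_nonneg (a - b), sq_nonneg (a + b)]
  rw [abs_of_nonneg (by positivity)]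
  nlinarith [mul_le_mul_of_nonneg_left h2 hl]

/-- `|V'(r) - V'(r')| ≤ (1 + 2β(r² + r'²)) |r - r'|` for `V'(r) = r + β r³` (`β ≥ 0`). -/
theorem lightCone_deriv_V_sub_le (hβ : 0 ≤ β) (r r' : ℝ) :
    |deriv (pinnedChain ω₂ lam β γ).V r - deriv (pinnedChain ω₂ lam β γ).V r'| ≤
      (1 + 2 * β * (r ^ 2 + r' ^ 2)) * |r - r'| := by
  rw [pinnedChain_deriv_V, pinnedChain_deriv_V]
  have e : r + β * r ^ 3 - (r' + β * r' ^ 3) = (1 + β * (r ^ 2 + r * r' + r' ^ 2)) * (r - r') := by ring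
  rw [e, abs_mul]
  refine mul_le_mul_of_nonneg_right ?_ (abs_nonneg _)
  have h1 : 0 ≤ r ^ 2 + r * r' + r' ^ 2 := by nlinarith [sq_nonneg (r + r'), sq_nonneg r, sq_nonneg r']
  have h2 : r ^ 2 + r * r' + r' ^ 2 ≤ 2 * (r ^ 2 + r' ^ 2) := by nlinarith [sq_nonneg (r - r'), sq_nonneg (r + r')]
  rw [abs_of_nonneg (by positivity)]
  nlinarith [mul_le_mul_of_nonneg_left h2 hβ]

/-- One bond: `|V'(q_l - q_k) - V'(q'_l - q'_k)| ≤ L · (|δ_l| + |δ_k|)` with the local factor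
`L = (ω₂+1) + 8(lam+β)(‖q‖² + ‖q'‖²)`. -/
theorem lightCone_bond_sub_le (hω : 0 < ω₂) (hl : 0 ≤ lam) (hβ : 0 ≤ β) (q q' : Fin (n + 1) → ℝ) (k l : Fin (n + 1)) :
    |deriv (pinnedChain ω₂ lam β γ).V (q l - q k) - deriv (pinnedChain ω₂ lam β γ).V (q' l - q' k)| ≤
      ((ω₂ + 1) + 8 * (lam + β) * (‖q‖ ^ 2 + ‖q'‖ ^ 2)) * (|q l - q' l| + |q k - q' k|) := by
  have h := lightCone_deriv_V_sub_le (ω₂ := ω₂) (lam := lam) (γ := γ) hβ (q l - q k) (q' l - q' k)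
  refine h.trans ?_
  have hql := lightCone_sq_apply_le q l
  have hqk := lightCone_sq_apply_le q k
  have hql' := lightCone_sq_apply_le q' l
  have hqk' := lightCone_sq_apply_le q' k
  have hr : (q l - q k) ^ 2 + (q' l - q' k) ^ 2 ≤ 4 * (‖q‖ ^ 2 + ‖q'‖ ^ 2) := by
    nlinarith [sq_nonneg (q l + q k), sq_nonneg (q' l + q' k)]
  have hd : |q l - q k - (q' l - q' k)| ≤ |q l - q' l| + |q k - q' k| := by
    rw [show q l - q k - (q' l - q' k) = (q l - q' l) - (q k - q' k) by ring]
    exact abs_sub _ _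
  have hL1 : 1 + 2 * β * ((q l - q k) ^ 2 + (q' l - q' k) ^ 2) ≤ (ω₂ + 1) + 8 * (lam + β) * (‖q‖ ^ 2 + ‖q'‖ ^ 2) := by
    have : 0 ≤ lam * (‖q‖ ^ 2 + ‖q'‖ ^ 2) := by positivity
    nlinarith [mul_le_mul_of_nonneg_left hr (by positivity : (0:ℝ) ≤ 2 * β)]
  have h0 : 0 ≤ 1 + 2 * β * ((q l - q k) ^ 2 + (q' l - q' k) ^ 2) := by positivity
  calc (1 + 2 * β * ((q l - q k) ^ 2 + (q' l - q' k) ^ 2)) * |q l - q k - (q' l - q' k)|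
      ≤ (1 + 2 * β * ((q l - q k) ^ 2 + (q' l - q' k) ^ 2)) * (|q l - q' l| + |q k - q' k|) :=
        mul_le_mul_of_nonneg_left hd h0
    _ ≤ ((ω₂ + 1) + 8 * (lam + β) * (‖q‖ ^ 2 + ‖q'‖ ^ 2)) * (|q l - q' l| + |q k - q' k|) :=
        mul_le_mul_of_nonneg_right hL1 (by positivity)

/-- **Nearest-neighbour Lipschitz bound for the force**: with `δ = q - q'`, the padded
`m_j = |δ_j|` (`0` for `j > n`) and `L = (ω₂+1) + 8(lam+β)(‖q‖² + ‖q'‖²)`,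
`|∂_iΦ(q) - ∂_iΦ(q')| ≤ L (3|δ_i| + m_{i-1} + m_{i+1})`. -/
theorem lightCone_dPotential_sub_le (hω : 0 < ω₂) (hl : 0 ≤ lam) (hβ : 0 ≤ β) (q q' : Fin (n + 1) → ℝ)
    (i : Fin (n + 1)) :
    |(pinnedChain ω₂ lam β γ).dPotential (n + 1) i q - (pinnedChain ω₂ lam β γ).dPotential (n + 1) i q'| ≤
      ((ω₂ + 1) + 8 * (lam + β) * (‖q‖ ^ 2 + ‖q'‖ ^ 2)) *
        (3 * |q i - q' i| +
          (if h : i.val - 1 < n + 1 then |q ⟨i.val - 1, h⟩ - q' ⟨i.val - 1, h⟩| else 0) +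
          (if h : i.val + 1 < n + 1 then |q ⟨i.val + 1, h⟩ - q' ⟨i.val + 1, h⟩| else 0)) := by
  set P := pinnedChain ω₂ lam β γ with hP
  set L := (ω₂ + 1) + 8 * (lam + β) * (‖q‖ ^ 2 + ‖q'‖ ^ 2) with hL
  have hL0 : 0 ≤ L := by positivity
  set mL := (if h : i.val - 1 < n + 1 then |q ⟨i.val - 1, h⟩ - q' ⟨i.val - 1, h⟩| else 0) with hmL
  set mR := (if h : i.val + 1 < n + 1 then |q ⟨i.val + 1, h⟩ - q' ⟨i.val + 1, h⟩| else 0) with hmR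
  have hmL0 : 0 ≤ mL := by rw [hmL]; split_ifs <;> positivity
  have hmR0 : 0 ≤ mR := by rw [hmR]; split_ifs <;> positivity
  rw [P.dPotential_eq_closed, P.dPotential_eq_closed]
  -- the three pieces
  have hU : |deriv P.U (q i) - deriv P.U (q' i)| ≤ L * |q i - q' i| := by
    refine (lightCone_deriv_U_sub_le (β := β) (γ := γ) hω hl (q i) (q' i)).trans
      (mul_le_mul_of_nonneg_right ?_ (abs_nonneg _))
    have h1 := lightCone_sq_apply_le q i
    have h2 := lightCone_sq_apply_le q' i
    have : 0 ≤ β * (‖q‖ ^ 2 + ‖q'‖ ^ 2) := by positivity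
    nlinarith [mul_le_mul_of_nonneg_left (add_le_add h1 h2) hl]
  have hVL : |(if h : 0 < i.val then deriv P.V (q i - q ⟨i.val - 1, by omega⟩) else 0) -
      (if h : 0 < i.val then deriv P.V (q' i - q' ⟨i.val - 1, by omega⟩) else 0)| ≤ L * (|q i - q' i| + mL) := by
    by_cases h0 : 0 < i.val
    · rw [dif_pos h0, dif_pos h0, hmL, dif_pos (by omega)]
      exact lightCone_bond_sub_le hω hl hβ q q' ⟨i.val - 1, by omega⟩ i
    · rw [dif_neg h0, dif_neg h0, sub_zero, abs_zero]
      positivity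
  have hVR : |(if h : i.val + 1 < n + 1 then deriv P.V (q ⟨i.val + 1, h⟩ - q i) else 0) -
      (if h : i.val + 1 < n + 1 then deriv P.V (q' ⟨i.val + 1, h⟩ - q' i) else 0)| ≤ L * (mR + |q i - q' i|) := by
    by_cases h1 : i.val + 1 < n + 1
    · rw [dif_pos h1, dif_pos h1, hmR, dif_pos h1]
      exact lightCone_bond_sub_le hω hl hβ q q' i ⟨i.val + 1, h1⟩
    · rw [dif_neg h1, dif_neg h1, sub_zero, abs_zero]
      positivity
  -- assemble: |(A + B - C) - (A' + B' - C')| ≤ |A - A'| + |B - B'| + |C - C'|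
  have key : ∀ A B C A' B' C' : ℝ, |A + B - C - (A' + B' - C')| ≤ |A - A'| + |B - B'| + |C - C'| := by
    intro A B C A' B' C'
    rw [show A + B - C - (A' + B' - C') = (A - A') + (B - B') - (C - C') by ring]
    exact (abs_sub _ _).trans (add_le_add (abs_add_le _ _) le_rfl)
  refine (key _ _ _ _ _ _).trans ?_
  nlinarith [hU, hVL, hVR]

/-- **The site inequality** (real arithmetic): with `e = a² + b²` the site energy (`a = δq_i`,
`b = δp_i`), force defect `|Δ| ≤ L(3|a| + m₁ + m₂)` and neighbour energies `e₁ ≥ m₁²`, `e₂ ≥ m₂²`,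
the derivative `2ab + 2b(-Δ - γw b)` of `e` is at most `(1 + 5L)(e₁ + e + e₂)`. -/
theorem lightCone_site_alg {a b Δ γw L m₁ m₂ e₁ e₂ : ℝ} (hγw : 0 ≤ γw) (hL : 0 ≤ L)
    (he₁ : m₁ ^ 2 ≤ e₁) (he₂ : m₂ ^ 2 ≤ e₂) (hΔ : |Δ| ≤ L * (3 * |a| + m₁ + m₂)) :
    (b * a + a * b) + ((-Δ - γw * b) * b + b * (-Δ - γw * b)) ≤ (1 + 5 * L) * (e₁ + (a * a + b * b) + e₂) := by
  have hab : 2 * |a| * |b| ≤ a * a + b * b := by nlinarith [sq_nonneg (|a| - |b|), sq_abs a, sq_abs b]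
  have h1 : b * a + a * b ≤ a * a + b * b := by nlinarith [sq_nonneg (a - b)]
  have h2 : (-Δ - γw * b) * b + b * (-Δ - γw * b) ≤ 2 * |b| * |Δ| := by
    have : (-Δ - γw * b) * b + b * (-Δ - γw * b) = -(2 * (b * Δ)) - 2 * γw * (b * b) := by ring
    rw [this]
    have h3 : -(2 * (b * Δ)) ≤ 2 * |b| * |Δ| := by
      rw [mul_assoc, ← abs_mul]; nlinarith [neg_abs_le (b * Δ)]
    nlinarith [mul_self_nonneg b]
  have h4 : 2 * |b| * |Δ| ≤ 2 * |b| * (L * (3 * |a| + m₁ + m₂)) :=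
    mul_le_mul_of_nonneg_left hΔ (by positivity)
  have h5 : 2 * |b| * m₁ ≤ b * b + m₁ ^ 2 := by nlinarith [sq_nonneg (|b| - m₁), sq_abs b]
  have h6 : 2 * |b| * m₂ ≤ b * b + m₂ ^ 2 := by nlinarith [sq_nonneg (|b| - m₂), sq_abs b]
  have h7 : 2 * |b| * (L * (3 * |a| + m₁ + m₂)) ≤ L * (3 * (a * a + b * b) + (b * b + e₁) + (b * b + e₂)) := by
    have := mul_le_mul_of_nonneg_left hab hL
    have := mul_le_mul_of_nonneg_left h5 hL
    have := mul_le_mul_of_nonneg_left h6 hL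
    nlinarith
  have he₁0 : 0 ≤ e₁ := le_trans (sq_nonneg _) he₁
  have he₂0 : 0 ≤ e₂ := le_trans (sq_nonneg _) he₂
  nlinarith [mul_nonneg hL he₁0, mul_nonneg hL he₂0, mul_self_nonneg a, mul_self_nonneg b]

end Force

/-! ### The pathwise light cone -/

section Pathwise

variable {ω₂ lam β γ : ℝ} (hω : 0 < ω₂) (hl : 0 ≤ lam) (hβ : 0 ≤ β) (hγ : 0 ≤ γ) (n : ℕ)
include hω hl hβ hγ

/-- **Pathwise light cone for the driven flow.** Two solutions of the same noise-driven pinned chain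
whose initial data differ only in `p₀` (`x' = (x.1, update x.2 0 s)`):
`(p_n(t) - p'_n(t))² ≤ (p₀ - s)² e^{A(t)} A(t)^n/n!`, `A(t) = 4∫₀ᵗ(1 + 5L)`,
`L(r) = (ω₂+1) + 8(lam+β)(‖q(r)‖² + ‖q'(r)‖²)`. -/
theorem lightCone_chainFlow_pathwise {η : ℝ → Fin (n + 1) → ℝ} (hη : Continuous η) (x : PhaseSpace (n + 1)) (s : ℝ)
    {t : ℝ} (ht : 0 ≤ t) :
    (((pinnedChain ω₂ lam β γ).chainFlow (n + 1) x η t).2 (Fin.last n) -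
        ((pinnedChain ω₂ lam β γ).chainFlow (n + 1) (x.1, Function.update x.2 0 s) η t).2 (Fin.last n)) ^ 2 ≤
      (x.2 0 - s) ^ 2 * Real.exp (4 * ∫ r in (0:ℝ)..t, (1 + 5 * ((ω₂ + 1) + 8 * (lam + β) *
          (‖((pinnedChain ω₂ lam β γ).chainFlow (n + 1) x η r).1‖ ^ 2 +
            ‖((pinnedChain ω₂ lam β γ).chainFlow (n + 1) (x.1, Function.update x.2 0 s) η r).1‖ ^ 2)))) *
        (4 * ∫ r in (0:ℝ)..t, (1 + 5 * ((ω₂ + 1) + 8 * (lam + β) *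
          (‖((pinnedChain ω₂ lam β γ).chainFlow (n + 1) x η r).1‖ ^ 2 +
            ‖((pinnedChain ω₂ lam β γ).chainFlow (n + 1) (x.1, Function.update x.2 0 s) η r).1‖ ^ 2)))) ^ n /
          n.factorial := by
  set P := pinnedChain ω₂ lam β γ with hP
  set x' : PhaseSpace (n + 1) := (x.1, Function.update x.2 0 s) with hx'
  set z := P.chainFlow (n + 1) x η with hz
  set z' := P.chainFlow (n + 1) x' η with hz'
  set Y := P.drift (n + 1) with hY
  -- regularity of the data
  have hzc : Continuous z := pinnedChain_continuous_chainFlow hω hl hβ hγ (n + 1) x hη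
  have hz'c : Continuous z' := pinnedChain_continuous_chainFlow hω hl hβ hγ (n + 1) x' hη
  have hYc : Continuous Y := (pinnedChain_contDiff_drift ω₂ lam β γ (n + 1) (n := 0)).continuous
  have hsol := pinnedChain_isIntegralSolutionOn_chainFlow hω hl hβ hγ (n + 1) x hη t
  have hsol' := pinnedChain_isIntegralSolutionOn_chainFlow hω hl hβ hγ (n + 1) x' hη t
  have hUd : Differentiable ℝ P.U := (pinnedChain_contDiff_U ω₂ lam β γ (n := 1)).differentiable one_ne_zero
  have hVd : Differentiable ℝ P.V := (pinnedChain_contDiff_V ω₂ lam β γ (n := 1)).differentiable one_ne_zero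
  -- the difference `G = (x - x') + ∫ (Y z - Y z')`, a `C¹` path equal to `z - z'` on `[0, t]`
  set g : ℝ → PhaseSpace (n + 1) := fun r => Y (z r) - Y (z' r) with hg
  have hgc : Continuous g := (hYc.comp hzc).sub (hYc.comp hz'c)
  set G : ℝ → PhaseSpace (n + 1) := fun u => (x - x') + ∫ r in (0:ℝ)..u, g r with hG
  have hGd : ∀ u, HasDerivAt G (g u) u := fun u =>
    (intervalIntegral.integral_hasDerivAt_right (hgc.intervalIntegrable _ _)
      (hgc.stronglyMeasurableAtFilter _ _) hgc.continuousAt).const_add _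
  have hGeq : ∀ u ∈ Icc 0 t, G u = z u - z' u := by
    intro u hu
    have hzu : z u = forcing x η u + ∫ r in (0:ℝ)..u, Y (z r) := hsol u hu
    have hz'u : z' u = forcing x' η u + ∫ r in (0:ℝ)..u, Y (z' r) := hsol' u hu
    rw [hzu, hz'u, hG]
    simp only [hg]
    have hi1 : IntervalIntegrable (fun r => Y (z r)) volume 0 u := (hYc.comp hzc).intervalIntegrable _ _
    have hi2 : IntervalIntegrable (fun r => Y (z' r)) volume 0 u := (hYc.comp hz'c).intervalIntegrable _ _
    rw [intervalIntegral.integral_sub hi1 hi2, ← forcing_sub_forcing x x' η u]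
    abel
  -- coordinates of `G` and their derivatives
  have hq : ∀ (i : Fin (n + 1)) (u : ℝ), HasDerivAt (fun u => (G u).1 i) ((g u).1 i) u := fun i u =>
    ((ContinuousLinearMap.proj i).comp
      (ContinuousLinearMap.fst ℝ (Fin (n + 1) → ℝ) (Fin (n + 1) → ℝ))).hasFDerivAt.comp_hasDerivAt u (hGd u)
  have hp : ∀ (i : Fin (n + 1)) (u : ℝ), HasDerivAt (fun u => (G u).2 i) ((g u).2 i) u := fun i u =>
    ((ContinuousLinearMap.proj i).comp
      (ContinuousLinearMap.snd ℝ (Fin (n + 1) → ℝ) (Fin (n + 1) → ℝ))).hasFDerivAt.comp_hasDerivAt u (hGd u)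
  -- padded site energies
  set e : ℕ → ℝ → ℝ := fun j u => if h : j < n + 1 then
    (G u).1 ⟨j, h⟩ * (G u).1 ⟨j, h⟩ + (G u).2 ⟨j, h⟩ * (G u).2 ⟨j, h⟩ else 0 with he
  set e' : ℕ → ℝ → ℝ := fun j u => if h : j < n + 1 then
    ((g u).1 ⟨j, h⟩ * (G u).1 ⟨j, h⟩ + (G u).1 ⟨j, h⟩ * (g u).1 ⟨j, h⟩) +
      ((g u).2 ⟨j, h⟩ * (G u).2 ⟨j, h⟩ + (G u).2 ⟨j, h⟩ * (g u).2 ⟨j, h⟩) else 0 with he'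
  have hed : ∀ j u, HasDerivAt (e j) (e' j u) u := by
    intro j u
    by_cases hj : j < n + 1
    · simp only [he, he', dif_pos hj]
      exact ((hq _ u).mul (hq _ u)).add ((hp _ u).mul (hp _ u))
    · simp only [he, he', dif_neg hj]
      exact hasDerivAt_const u 0
  have he0 : ∀ j u, 0 ≤ e j u := by
    intro j u; simp only [he]; split_ifs
    · nlinarith [mul_self_nonneg ((G u).1 ⟨j, by omega⟩), mul_self_nonneg ((G u).2 ⟨j, by omega⟩)]
    · exact le_rfl
  have hvan : ∀ j, n < j → ∀ u, e j u = 0 := fun j hj u => by simp only [he, dif_neg (by omega : ¬ j < n + 1)]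
  have hinit : ∀ j, 1 ≤ j → e j 0 = 0 := by
    intro j hj
    simp only [he]
    split_ifs with h
    · have hG0 : G 0 = x - x' := by simp [hG]
      rw [hG0]
      have h1 : (x - x').1 ⟨j, h⟩ = 0 := by simp [hx']
      have h2 : (x - x').2 ⟨j, h⟩ = 0 := by
        have hne : (⟨j, h⟩ : Fin (n + 1)) ≠ 0 := fun hh => by
          have := congrArg Fin.val hh; simp at this; omega
        simp [hx', Function.update_of_ne hne]
      rw [h1, h2]; ring
    · rfl
  -- the local rate
  set Lf : ℝ → ℝ := fun u => (ω₂ + 1) + 8 * (lam + β) * (‖(z u).1‖ ^ 2 + ‖(z' u).1‖ ^ 2) with hLf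
  set c : ℝ → ℝ := fun u => 1 + 5 * Lf u with hc
  have hLf0 : ∀ u, 0 ≤ Lf u := fun u => by positivity
  have hcc : Continuous c := by
    simp only [hc, hLf]
    have h1 : Continuous fun u => ‖(z u).1‖ := (continuous_fst.comp hzc).norm
    have h2 : Continuous fun u => ‖(z' u).1‖ := (continuous_fst.comp hz'c).norm
    fun_prop
  have hc0 : ∀ u, 0 ≤ c u := fun u => by have := hLf0 u; positivity
  -- the nearest-neighbour differential inequalities on `[0, t]`
  have hloc : ∀ j, ∀ u ∈ Icc 0 t, e' j u ≤ c u * (e (j - 1) u + e j u + e (j + 1) u) := by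
    intro j u hu
    by_cases hj : j < n + 1
    swap
    · simp only [he', dif_neg hj]
      exact mul_nonneg (hc0 u) (add_nonneg (add_nonneg (he0 _ _) (he0 _ _)) (he0 _ _))
    set i : Fin (n + 1) := ⟨j, hj⟩ with hi
    have hGu := hGeq u hu
    -- identify the derivative of `G` at `u` through `G u = z u - z' u`
    have hg1 : (g u).1 i = (G u).2 i := by
      simp only [hg, hGu, hY, OscillatorChain.drift, Prod.fst_sub, Prod.snd_sub, Pi.sub_apply]
    have hg2 : (g u).2 i = -(P.dPotential (n + 1) i (z u).1 - P.dPotential (n + 1) i (z' u).1) -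
        γ * bathWeight (n + 1) i * (G u).2 i := by
      simp only [hg, hGu, hY, OscillatorChain.drift, Prod.snd_sub, Pi.sub_apply,
        P.partialQ_hamiltonian_eq_dPotential hUd hVd]
      have : P.γ = γ := rfl
      rw [this]; ring
    have hw0 : 0 ≤ γ * bathWeight (n + 1) i := mul_nonneg hγ (by unfold bathWeight; split_ifs <;> norm_num)
    -- the force defect
    have hΔ := lightCone_dPotential_sub_le (γ := γ) hω hl hβ (z u).1 (z' u).1 i
    have hq1 : (z u).1 - (z' u).1 = (G u).1 := by rw [hGu, Prod.fst_sub]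
    have habs : ∀ (k : ℕ) (hk : k < n + 1), |(z u).1 ⟨k, hk⟩ - (z' u).1 ⟨k, hk⟩| = |(G u).1 ⟨k, hk⟩| := by
      intro k hk; rw [← hq1, Pi.sub_apply]
    -- padded neighbour data
    set m₁ : ℝ := if h : j - 1 < n + 1 then |(G u).1 ⟨j - 1, h⟩| else 0 with hm₁
    set m₂ : ℝ := if h : j + 1 < n + 1 then |(G u).1 ⟨j + 1, h⟩| else 0 with hm₂
    have hme₁ : m₁ ^ 2 ≤ e (j - 1) u := by
      simp only [hm₁, he]
      split_ifs
      · nlinarith [sq_abs ((G u).1 ⟨j - 1, by omega⟩), mul_self_nonneg ((G u).2 ⟨j - 1, by omega⟩)]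
      · simp
    have hme₂ : m₂ ^ 2 ≤ e (j + 1) u := by
      simp only [hm₂, he]
      split_ifs
      · nlinarith [sq_abs ((G u).1 ⟨j + 1, by omega⟩), mul_self_nonneg ((G u).2 ⟨j + 1, by omega⟩)]
      · simp
    have hΔ' : |P.dPotential (n + 1) i (z u).1 - P.dPotential (n + 1) i (z' u).1| ≤
        Lf u * (3 * |(G u).1 i| + m₁ + m₂) := by
      refine hΔ.trans (le_of_eq ?_)
      simp only [hLf, hm₁, hm₂, hi, habs]
    have halg := lightCone_site_alg (a := (G u).1 i) (b := (G u).2 i) hw0 (hLf0 u) hme₁ hme₂ hΔ'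
    simp only [he', he, dif_pos hj, hc]
    rw [hg1, hg2]
    exact halg
  -- the hierarchy
  have hmain := lightCone_lattice_gronwall n t c e e' hcc hc0 hed he0 hvan hloc hinit t ⟨ht, le_rfl⟩
  -- read off site `n`
  have hen : ((z t).2 (Fin.last n) - (z' t).2 (Fin.last n)) ^ 2 ≤ e n t := by
    have hGt := hGeq t ⟨ht, le_rfl⟩
    simp only [he, dif_pos (Nat.lt_succ_self n)]
    have : (z t).2 (Fin.last n) - (z' t).2 (Fin.last n) = (G t).2 ⟨n, Nat.lt_succ_self n⟩ := by
      rw [hGt]; rfl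
    rw [this]
    nlinarith [mul_self_nonneg ((G t).1 ⟨n, Nat.lt_succ_self n⟩)]
  have he00 : e 0 0 = (x.2 0 - s) ^ 2 := by
    have hG0 : G 0 = x - x' := by simp [hG]
    simp only [he, dif_pos (Nat.succ_pos n), hG0]
    have h1 : (x - x').1 ⟨0, Nat.succ_pos n⟩ = 0 := by simp [hx']
    have h2 : (x - x').2 ⟨0, Nat.succ_pos n⟩ = x.2 0 - s := by
      show x.2 0 - Function.update x.2 0 s 0 = x.2 0 - s
      rw [Function.update_self]
    rw [h1, h2]; ring
  rw [he00] at hmain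
  exact hen.trans hmain

end Pathwise

/-- **Registered helper `lightCone_pathwise` — the pathwise light cone of the constructed dynamics.**
For `P = pinnedChain ω₂ lam β γ` (`ω₂ > 0`, `lam, β, γ ≥ 0`) and the solution map `Φ_t = P.solMap`
(pathwise flow driven by a pair of raw noise paths `w`, the map behind the transition kernels), two
microstates differing ONLY in `p₀` give far momenta with
`(p_n(t) - p̃_n(t))² ≤ (p₀ - s)² e^{A} A^n / n!`, `A = 4∫₀ᵗ (1 + 5((ω₂+1) + 8(lam+β)(‖q(r)‖² + ‖q̃(r)‖²))) dr`
— super-polynomially small in `n` as long as `A ≪ n` (finite speed of propagation, same noise). -/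
theorem lightCone_pathwise : ∀ ω₂ lam β γ : ℝ, 0 < ω₂ → 0 ≤ lam → 0 ≤ β → 0 ≤ γ →
    ∀ (T_L T_R : ℝ) (n : ℕ) (x : PhaseSpace (n + 1)) (s : ℝ) (w : WienerPair) (t : ℝ), 0 ≤ t →
      (((pinnedChain ω₂ lam β γ).solMap (n + 1) T_L T_R t x w).2 (Fin.last n) -
          ((pinnedChain ω₂ lam β γ).solMap (n + 1) T_L T_R t (x.1, Function.update x.2 0 s) w).2 (Fin.last n)) ^ 2 ≤
        (x.2 0 - s) ^ 2 * Real.exp (4 * ∫ r in (0:ℝ)..t, (1 + 5 * ((ω₂ + 1) + 8 * (lam + β) *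
            (‖((pinnedChain ω₂ lam β γ).solMap (n + 1) T_L T_R r x w).1‖ ^ 2 +
              ‖((pinnedChain ω₂ lam β γ).solMap (n + 1) T_L T_R r (x.1, Function.update x.2 0 s) w).1‖ ^ 2)))) *
          (4 * ∫ r in (0:ℝ)..t, (1 + 5 * ((ω₂ + 1) + 8 * (lam + β) *
            (‖((pinnedChain ω₂ lam β γ).solMap (n + 1) T_L T_R r x w).1‖ ^ 2 +
              ‖((pinnedChain ω₂ lam β γ).solMap (n + 1) T_L T_R r (x.1, Function.update x.2 0 s) w).1‖ ^ 2)))) ^ n /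
            n.factorial := by
  intro ω₂ lam β γ hω hl hβ hγ T_L T_R n x s w t ht
  exact lightCone_chainFlow_pathwise hω hl hβ hγ n (continuous_chainNoise _ _ w) x s ht

end Summit.AtomisticToContinuum.FouriersLaw.Theorems.PhononMeanFreePath

end
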